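import Mathlib
import HarnessLib
import HarnessLib.Audit
import Summits.Langlands.Statement
import Summits.Langlands.Langlands.Theses.SkinnerWilesDefectOne
import Literature.NumberTheory.Automorphic.AutomorphicInductionCharacter
import Literature.NumberTheory.Automorphic.ReciprocityGLn
import Literature.NumberTheory.GaloisRepresentations.OrdinaryGaloisRep
import Literature.NumberTheory.GaloisRepresentations.GaloisRep
import Literature.NumberTheory.GaloisRepresentations.HeckeCharacter
import Literature.FieldTheory.AlgClosed.PadicAlgClEquivComplex
import Summits.Langlands.Langlands.Theorems.SkinnerWilesDefectOneSymmetryType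
import Summits.Langlands.Langlands.Theorems.SkinnerWilesDefectOneProModularOrdinaryClassicalCmSatakeFrobGlue

/-!
# SkinnerWilesDefectOneSymmetryTypeStubs — stub compositions of the symmetry-type cells (tree twin, Part B, of the lens-2 g18 node `SymmetryTypeSplit`)

Imports Part A (`SkinnerWilesDefectOneSymmetryType`).  §1 the CM Satake–Frobenius glue is the tree's landed
`Cruxes.ProModularOrdinaryClassical.TopDegreeExactControl.stub_cmSatakeFrobGlue` (`Theorems/SkinnerWilesDefectOneProModularOrdinaryClassicalCmSatakeFrobGlue.lean`),
IMPORTED here (the node re-proved it verbatim; census landing reuses the tree declaration); §2 the REAL proofs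
`cmModular_of_stubs`, `oddDescentModular_of_stubs`, `cmProModular_of_stubs`, `oddDescentProModular_of_stubs` (special cells from their layer-2 stubs), and
`target_of_stubs_and_generic` / `langlands_of_stubs_and_generic` (what the host blockers reduce to modulo the five special-sector stubs).  0 sorry.
-/

set_option linter.dupNamespace false
set_option linter.unusedVariables false

namespace Summit.Langlands.Langlands.Theorems.SkinnerWilesDefectOneSymmetryTypeStubs

open scoped NumberField
open Filter Field IsDedekindDomain
open Literature.NumberTheory.GaloisRepresentations Literature.NumberTheory.Automorphic
open Summit.Langlands.Langlands.Theorems.SkinnerWilesDefectOneSymmetryType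

/-! ### The CM Satake–Frobenius glue is the tree's LANDED `Cruxes.ProModularOrdinaryClassical.TopDegreeExactControl.stub_cmSatakeFrobGlue`
(`Theorems/SkinnerWilesDefectOneProModularOrdinaryClassicalCmSatakeFrobGlue.lean`, imported; the node re-proved it verbatim, the tree copy is reused here) -/

/-! ### Layer 2 of the special cells: the stub compositions (REAL proofs over the stubs) -/

/-- **CM cell from its two stubs** (kernel-checked): Galois side CM-1 + automorphic induction CM-2, glued by the tree's LANDED
`stub_cmSatakeFrobGlue` (imported). -/
theorem cmModular_of_stubs (hA : SelfTwistInducedCharacter) (hB : CMInducedCuspidal) : CMModular := by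
  intro F _ _ hF hdeg p _ hp O hO hcpt ι ρ ρ₀ hirr hunr hmod hord hst
  obtain ⟨K, _iK, _iNK, _iA, hK2, θ, halg, hreg, hfrob⟩ := hA F hF hdeg p hp O hO ι ρ ρ₀ hirr hunr hmod hord hst
  obtain ⟨π, hL, hsat⟩ := hB F hcpt K hK2 θ halg hreg
  exact ⟨π, hL, Summit.Langlands.Langlands.Cruxes.ProModularOrdinaryClassical.TopDegreeExactControl.stub_cmSatakeFrobGlue F p hcpt ι ρ K hK2 θ π hsat hfrob⟩

/-- primes above `p` are finitely many. -/
theorem finite_setOf_natCast_mem {F : Type} [Field F] [NumberField F] {p : ℕ} (hp : p ≠ 0) :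
    {v : HeightOneSpectrum (𝓞 F) | ((p : ℕ) : 𝓞 F) ∈ v.asIdeal}.Finite := by
  have h : Ideal.span {((p : ℕ) : 𝓞 F)} ≠ ⊥ := by
    rw [ne_eq, Ideal.span_singleton_eq_bot]
    exact_mod_cast hp
  refine (Ideal.finite_factors h).subset fun v hv => ?_
  exact Ideal.dvd_iff_le.mpr ((Ideal.span_singleton_le_iff_mem _).mpr hv)

/-- **Odd-descent cell from its three stubs** (kernel-checked): Skinner–Wiles over ℚ for the descended `ρ'` (OBC-1), the exceptional set
`S = {v ∣ p} ∪ {ρ ramified} ∪ {ν ramified}` is finite (OBC-2 + the cell's a.e.-unramified hypothesis), then quadratic base change + twist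
(OBC-3 = the tree's landed conditional theorem) gives a cuspidal L-algebraic `π_F` compatible with `ρ = ν ⊗ ρ'|_{Γ_F}` off `S`. -/
theorem oddDescentModular_of_stubs (hA : OddDescentClassicalOverQ) (hB : FiniteOrderCharacterUnramifiedAE)
    (hC : QuadraticBaseChangeTwistTransport) : OddDescentModular := by
  intro F _ _ hF hdeg p _ hp O hO hcpt ι ρ ρ₀ hirr hunr hmod hord hst hobc
  obtain ⟨ρ', ν, hodd, hfin, hr⟩ := hobc
  obtain ⟨π, T, hT, hTL, hTR, hcompat⟩ :=
    hA F hF hdeg p hp O hO ι ρ ρ₀ hirr hunr hmod hord hst ρ' ν hodd hfin hr (isCompact_glFiniteIntegralLevel_holds 2 ℚ)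
  have hν := hB F p ν hfin
  set S : Set (HeightOneSpectrum (𝓞 F)) := {v | ((p : ℕ) : 𝓞 F) ∈ v.asIdeal} ∪ {v | ¬ ρ.IsUnramifiedAt v} ∪
    {v | ¬ ∀ 𝔓 ∈ v.primesAbove, ∀ σ ∈ 𝔓.inertia (Field.absoluteGaloisGroup F), ν σ = 1} with hS
  have hSfin : S.Finite :=
    ((finite_setOf_natCast_mem (Fact.out : p.Prime).ne_zero).union (Filter.eventually_cofinite.mp hunr)).union
      (Filter.eventually_cofinite.mp hν)
  obtain ⟨πF, T', hT', hT'L, -, hcomp⟩ := hC F hF hdeg p (isCompact_glFiniteIntegralLevel_holds 2 ℚ) ι π T hT hTL hTR ρ' hcompat ν hfin ρ hr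
    hirr S hSfin (fun v hv => Or.inl (Or.inl hv)) (fun v hv => by_contra fun h => hv (Or.inl (Or.inr h)))
    (fun v hv => by_contra fun h => hv (Or.inr h)) hcpt
  exact ⟨πF, ⟨T', hT', hT'L⟩, Filter.mem_of_superset hSfin.compl_mem_cofinite fun v hv => hcomp v hv⟩

/-- the engine cells from the stubs and the dictionary (compositions of the above). -/
theorem cmProModular_of_stubs (hA : SelfTwistInducedCharacter) (hB : CMInducedCuspidal) (hD : ClassicalOrdinaryProModular) : CMProModular :=
  cmProModular_of_classical (cmModular_of_stubs hA hB) hD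

/-- the OBC engine cell E_obc from the stubs OBC-1/2/3 and the dictionary (composition). -/
theorem oddDescentProModular_of_stubs (hA : OddDescentClassicalOverQ) (hB : FiniteOrderCharacterUnramifiedAE)
    (hC : QuadraticBaseChangeTwistTransport) (hD : ClassicalOrdinaryProModular) : OddDescentProModular :=
  oddDescentProModular_of_classical (oddDescentModular_of_stubs hA hB hC) hD

/-! ### What the blockers reduce to -/

/-- **The host target from the five special-stratum stubs, the residual GEN engine cell and the EXIT** — i.e. modulo print
(SW over ℚ, base change, automorphic induction, a folklore lemma) the host's target X needs its two blockers ONLY on the generic stratum. -/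
theorem target_of_stubs_and_generic (hA : OddDescentClassicalOverQ) (hB : FiniteOrderCharacterUnramifiedAE)
    (hC : QuadraticBaseChangeTwistTransport) (hA' : SelfTwistInducedCharacter) (hB' : CMInducedCuspidal)
    (hG : GenericProModular) (hX : Summit.Langlands.Langlands.Theses.SkinnerWilesDefectOne.ProModularOrdinaryClassical) :
    Summit.Langlands.Langlands.Theses.SkinnerWilesDefectOne.ReducibleOrdinaryModular :=
  closes_target (cmModular_of_stubs hA' hB') (oddDescentModular_of_stubs hA hB hC) (genericModular_of_engine hG hX)

/-- … and the summit from the same plus the host's residual. -/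
theorem langlands_of_stubs_and_generic (hA : OddDescentClassicalOverQ) (hB : FiniteOrderCharacterUnramifiedAE)
    (hC : QuadraticBaseChangeTwistTransport) (hA' : SelfTwistInducedCharacter) (hB' : CMInducedCuspidal)
    (hG : GenericProModular) (hX : Summit.Langlands.Langlands.Theses.SkinnerWilesDefectOne.ProModularOrdinaryClassical)
    (hSC : Summit.Langlands.Langlands.Theses.SkinnerWilesDefectOne.SectorComplement) : _root_.Langlands :=
  hSC (target_of_stubs_and_generic hA hB hC hA' hB' hG hX)

end Summit.Langlands.Langlands.Theorems.SkinnerWilesDefectOneSymmetryTypeStubs
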